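import Mathlib.Topology.Algebra.InfiniteSum.Real
import HarnessLib

/-!
# Venture YMGap, track Y3 FLOW-DATA — JOINT character truncation of a product of plaquette weights (lineage C, `Λ = 1³`):
# the pointwise tail of the kept set `Σ_p n_p ≤ L`, by recursion on the plaquettes

HONEST FRAMING: venture file of the cell `pub-ymgap` (QuantumFields programme), track Y3, lineage C (seat engine-3; kernels
«sce-onesite3» / «os3k», bookkeeping note `engine/sce/CERT-CHAIN-C.md` step S3).  Elementary real analysis of finite sums; NO group,
NO lattice, NO transfer matrix, no number of record, nothing about limits or a mass gap.

Lineage C's one-site `d = 4` engine expands each of the three plaquette weights in characters, `f(x) = Σ_n a_n(x)` with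
`|a_n(x)| ≤ t_n` (for `SU(2)`: `a_n(x) = c_n(β) χ_n(x)`, `t_n = (n+1) c_n(β)`, typed for ONE plaquette in lineage A's
`FlowData/PlaquetteCharacterTail`), and truncates the PRODUCT of the three expansions JOINTLY: it keeps the multi-indices with
`n₁ + n₂ + n₃ ≤ L` (`Σ_p 2J_p ≤ N` in the engine's spin labels) and bounds the dropped remainder pointwise by
`τ_L^{joint} = B³ − Σ_{n₁+n₂+n₃ ≤ L} t_{n₁} t_{n₂} t_{n₃}`, `B = Σ_n t_n = f(1)` (`CERT-CHAIN-C.md` S3: «τ_N = 1 − Σ_kept Π κ(2J+1)² a_J»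
after normalisation by `B`).  Lineage A brackets per plaquette instead, so this joint tail was the one untyped pointwise step of the
lineage-C standard certificate for `Λ = 1³`.  This file proves it for ANY family of factors given only the three single-factor facts
(`|f| ≤ B`, `|a_n| ≤ t_n`, single tails `|f − Σ_{n≤L} a_n| ≤ τ_L`), by recursion on the list of factors — no multi-dimensional series:

* `truncProd a L [x₁,…,x_k] = Σ_{n ≤ L} a_n(x₁) · truncProd a (L − n) [x₂,…,x_k]` — the jointly truncated product (`= Σ_{Σ nᵢ ≤ L} Π a_{nᵢ}(xᵢ)`);
* `tailBound τ t B k L = τ_L B^{k−1} + Σ_{n ≤ L} t_n · tailBound τ t B (k−1) (L−n)` and ★ `abs_prod_sub_truncProd_le`: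
  `|Π f(xᵢ) − truncProd a L xs| ≤ tailBound τ t B k L`;
* `tailBound_eq_pow_sub_keptSum`: if `τ_L = B − Σ_{n≤L} t_n` then `tailBound τ t B k L = B^k − keptSum t k L` with
  `keptSum t k L = Σ_{n≤L} t_n · keptSum t (k−1) (L−n)` (`= Σ_{Σnᵢ ≤ L} Π t_{nᵢ}`) — the engine's «1 − Σ_kept» form; and
  `tsum_shift_eq_sub_sum` — `τ_L = Σ_{n>L} t_n = B − Σ_{n≤L} t_n` from `HasSum t B`.

The operator step (pointwise bracket ⇒ sorted-eigenvalue sandwich of the compressed Galerkin matrices) is lineage A's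
`GalerkinWeightMonotone.eigenvalues₀_sandwich_of_pointwise`, unchanged.  References: I. Montvay, G. Münster, *Quantum Fields on a Lattice*
(1994) §3.2.6 (character expansion of the plaquette weight) [cite: MontvayMunster1994, §3.2.6]; the recursion itself is [folklore].
-/

noncomputable section

open Finset
open scoped BigOperators

namespace Summit.Ventures.YMGap.FlowData.JointCharacterTruncation

variable {X : Type*}

/-! ### Objects -/

/-- The JOINTLY truncated product of the expansions `f(x) = Σ_n a_n(x)` over a list of factors with total label budget `L`:
`truncProd a L [] = 1`, `truncProd a L (x :: xs) = Σ_{n ≤ L} a_n(x) · truncProd a (L − n) xs` — i.e. the sum of `Π a_{nᵢ}(xᵢ)`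
over the kept multi-indices `Σ nᵢ ≤ L` (the engine's `Σ_p 2J_p ≤ N`). [folklore] -/
def truncProd (a : ℕ → X → ℝ) : ℕ → List X → ℝ
  | _, [] => 1
  | L, x :: xs => ∑ n ∈ range (L + 1), a n x * truncProd a (L - n) xs

/-- The recursive tail bound for `k` factors and budget `L`: `tailBound τ t B 0 L = 0`,
`tailBound τ t B (k+1) L = τ_L · B^k + Σ_{n ≤ L} t_n · tailBound τ t B k (L − n)`. [folklore] -/
def tailBound (τ t : ℕ → ℝ) (B : ℝ) : ℕ → ℕ → ℝ
  | 0, _ => 0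
  | k + 1, L => τ L * B ^ k + ∑ n ∈ range (L + 1), t n * tailBound τ t B k (L - n)

/-- The kept mass `keptSum t k L = Σ_{Σ nᵢ ≤ L, i < k} Π t_{nᵢ}`, recursively: `keptSum t 0 L = 1`,
`keptSum t (k+1) L = Σ_{n ≤ L} t_n · keptSum t k (L − n)`. [folklore] -/
def keptSum (t : ℕ → ℝ) : ℕ → ℕ → ℝ
  | 0, _ => 1
  | k + 1, L => ∑ n ∈ range (L + 1), t n * keptSum t k (L - n)

/-- Unfolding: `truncProd a L [] = 1`. [folklore] -/
@[simp] theorem truncProd_nil (a : ℕ → X → ℝ) (L : ℕ) : truncProd a L [] = 1 := by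
  simp [truncProd]

/-- Unfolding: `truncProd a L (x :: xs) = Σ_{n ≤ L} a_n(x) · truncProd a (L − n) xs`. [folklore] -/
@[simp] theorem truncProd_cons (a : ℕ → X → ℝ) (L : ℕ) (x : X) (xs : List X) :
    truncProd a L (x :: xs) = ∑ n ∈ range (L + 1), a n x * truncProd a (L - n) xs := by
  simp [truncProd]

/-- Unfolding: `tailBound τ t B 0 L = 0`. [folklore] -/
@[simp] theorem tailBound_zero (τ t : ℕ → ℝ) (B : ℝ) (L : ℕ) : tailBound τ t B 0 L = 0 := by
  simp [tailBound]

/-- Unfolding: `tailBound τ t B (k+1) L = τ_L B^k + Σ_{n ≤ L} t_n · tailBound τ t B k (L − n)`. [folklore] -/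
@[simp] theorem tailBound_succ (τ t : ℕ → ℝ) (B : ℝ) (k L : ℕ) :
    tailBound τ t B (k + 1) L = τ L * B ^ k + ∑ n ∈ range (L + 1), t n * tailBound τ t B k (L - n) := by
  simp [tailBound]

/-- Unfolding: `keptSum t 0 L = 1`. [folklore] -/
@[simp] theorem keptSum_zero (t : ℕ → ℝ) (L : ℕ) : keptSum t 0 L = 1 := by
  simp [keptSum]

/-- Unfolding: `keptSum t (k+1) L = Σ_{n ≤ L} t_n · keptSum t k (L − n)`. [folklore] -/
@[simp] theorem keptSum_succ (t : ℕ → ℝ) (k L : ℕ) :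
    keptSum t (k + 1) L = ∑ n ∈ range (L + 1), t n * keptSum t k (L - n) := by
  simp [keptSum]

/-! ### The product bound and the recursive tail -/

/-- `|Π f(xᵢ)| ≤ B^k` from `|f| ≤ B`. [folklore] -/
theorem abs_prod_map_le {f : X → ℝ} {B : ℝ} (hf : ∀ x, |f x| ≤ B) (xs : List X) :
    |(xs.map f).prod| ≤ B ^ xs.length := by
  induction xs with
  | nil => simp
  | cons x xs ih =>
    rw [List.map_cons, List.prod_cons, List.length_cons, pow_succ', abs_mul]
    exact mul_le_mul (hf x) ih (abs_nonneg _) ((abs_nonneg _).trans (hf x))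

/-- The tail bound is non-negative when `τ, t, B ≥ 0`. [folklore] -/
theorem tailBound_nonneg {τ t : ℕ → ℝ} {B : ℝ} (hτ : ∀ L, 0 ≤ τ L) (ht : ∀ n, 0 ≤ t n) (hB : 0 ≤ B)
    (k L : ℕ) : 0 ≤ tailBound τ t B k L := by
  induction k generalizing L with
  | zero => simp
  | succ k ih =>
    rw [tailBound_succ]
    exact add_nonneg (mul_nonneg (hτ L) (pow_nonneg hB k))
      (sum_nonneg fun n _ => mul_nonneg (ht n) (ih (L - n)))

/-- ★ **Joint truncation tail.**  If every factor satisfies `|f(x)| ≤ B`, `|a_n(x)| ≤ t_n` and the single-factor tails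
`|f(x) − Σ_{n ≤ L} a_n(x)| ≤ τ_L` (all `L`), then for every list of factors and every budget `L`
`|Π f(xᵢ) − truncProd a L xs| ≤ tailBound τ t B (length xs) L`.  Proof: `f(x)·P − Σ_{n≤L} a_n(x) W_{L−n} =
(f(x) − Σ_{n≤L} a_n(x))·P + Σ_{n≤L} a_n(x)·(P − W_{L−n})`, `|P| ≤ B^k`, induction. [folklore] -/
theorem abs_prod_sub_truncProd_le {f : X → ℝ} {a : ℕ → X → ℝ} {τ t : ℕ → ℝ} {B : ℝ}
    (hf : ∀ x, |f x| ≤ B) (ha : ∀ n x, |a n x| ≤ t n)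
    (hτ : ∀ L x, |f x - ∑ n ∈ range (L + 1), a n x| ≤ τ L) (xs : List X) (L : ℕ) :
    |(xs.map f).prod - truncProd a L xs| ≤ tailBound τ t B xs.length L := by
  induction xs generalizing L with
  | nil => simp
  | cons x xs ih =>
    rw [List.map_cons, List.prod_cons, List.length_cons, truncProd_cons, tailBound_succ]
    set P := (xs.map f).prod with hP
    have hPB : |P| ≤ B ^ xs.length := abs_prod_map_le hf xs
    have hsplit : f x * P - ∑ n ∈ range (L + 1), a n x * truncProd a (L - n) xs
        = (f x - ∑ n ∈ range (L + 1), a n x) * P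
          + ∑ n ∈ range (L + 1), a n x * (P - truncProd a (L - n) xs) := by
      simp only [sub_mul, sum_mul, mul_sub, sum_sub_distrib]
      ring
    rw [hsplit]
    refine (abs_add_le _ _).trans (add_le_add ?_ ?_)
    · rw [abs_mul]
      exact mul_le_mul (hτ L x) hPB (abs_nonneg _) ((abs_nonneg _).trans (hτ L x))
    · refine (abs_sum_le_sum_abs _ _).trans (sum_le_sum fun n _ => ?_)
      rw [abs_mul]
      exact mul_le_mul (ha n x) (ih (L - n)) (abs_nonneg _) ((abs_nonneg _).trans (ha n x))

/-! ### The «B^k − kept mass» form of the tail and the series identity for `τ` -/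

/-- ★ If the single-factor tail is the FULL mass minus the kept mass, `τ_L = B − Σ_{n ≤ L} t_n`, then the joint tail bound is
`B^k − keptSum t k L` (the engine's `τ_N = 1 − Σ_kept Π κ (2J+1)² a_J` after normalising by `B`). [folklore] -/
theorem tailBound_eq_pow_sub_keptSum {τ t : ℕ → ℝ} {B : ℝ}
    (hτ : ∀ L, τ L = B - ∑ n ∈ range (L + 1), t n) (k L : ℕ) :
    tailBound τ t B k L = B ^ k - keptSum t k L := by
  induction k generalizing L with
  | zero => simp
  | succ k ih =>
    rw [tailBound_succ, keptSum_succ, hτ L, pow_succ]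
    have : ∑ n ∈ range (L + 1), t n * tailBound τ t B k (L - n)
        = ∑ n ∈ range (L + 1), (t n * B ^ k - t n * keptSum t k (L - n)) :=
      sum_congr rfl fun n _ => by rw [ih (L - n), mul_sub]
    rw [this, sum_sub_distrib, ← sum_mul]
    ring

/-- `keptSum` is non-negative for non-negative `t`. [folklore] -/
theorem keptSum_nonneg {t : ℕ → ℝ} (ht : ∀ n, 0 ≤ t n) (k L : ℕ) : 0 ≤ keptSum t k L := by
  induction k generalizing L with
  | zero => simp
  | succ k ih =>
    rw [keptSum_succ]; exact sum_nonneg fun n _ => mul_nonneg (ht n) (ih (L - n))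

/-- `keptSum` is monotone in the budget `L` for non-negative `t` (more kept labels, more kept mass). [folklore] -/
theorem keptSum_mono {t : ℕ → ℝ} (ht : ∀ n, 0 ≤ t n) (k : ℕ) {L L' : ℕ} (h : L ≤ L') :
    keptSum t k L ≤ keptSum t k L' := by
  induction k generalizing L L' with
  | zero => simp
  | succ k ih =>
    rw [keptSum_succ, keptSum_succ]
    calc ∑ n ∈ range (L + 1), t n * keptSum t k (L - n)
        ≤ ∑ n ∈ range (L + 1), t n * keptSum t k (L' - n) :=
          sum_le_sum fun n _ => mul_le_mul_of_nonneg_left (ih (Nat.sub_le_sub_right h n)) (ht n)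
      _ ≤ ∑ n ∈ range (L' + 1), t n * keptSum t k (L' - n) :=
          sum_le_sum_of_subset_of_nonneg (range_mono (Nat.add_le_add_right h 1))
            fun n _ _ => mul_nonneg (ht n) (keptSum_nonneg ht k _)

/-- The series identity behind `τ_L`: if `Σ_n t_n = B` then `Σ_{n > L} t_n = B − Σ_{n ≤ L} t_n`
(so the hypothesis of `tailBound_eq_pow_sub_keptSum` holds with `τ_L := Σ' n, t (n + (L+1))`). [folklore] -/
theorem tsum_shift_eq_sub_sum {t : ℕ → ℝ} {B : ℝ} (h : HasSum t B) (L : ℕ) :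
    ∑' n, t (n + (L + 1)) = B - ∑ n ∈ range (L + 1), t n := by
  have hs : Summable t := h.summable
  have := hs.sum_add_tsum_nat_add (L + 1)
  rw [h.tsum_eq] at this
  linarith

/-- ★ **Assembled, in the engine's form.**  With `Σ_n t_n = B` (all `t_n ≥ 0`), `|f| ≤ B`, `|a_n| ≤ t_n` and single tails bounded by the
series remainders `Σ_{n>L} t_n`, the jointly truncated product of `k` factors is within `B^k − keptSum t k L` of the full product,
pointwise; both sides of the resulting bracket `truncProd − τ ≤ Π f ≤ truncProd + τ` are what
`GalerkinWeightMonotone.eigenvalues₀_sandwich_of_pointwise` consumes. [folklore] -/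
theorem abs_prod_sub_truncProd_le_pow_sub_keptSum {f : X → ℝ} {a : ℕ → X → ℝ} {t : ℕ → ℝ} {B : ℝ}
    (hsum : HasSum t B) (hf : ∀ x, |f x| ≤ B) (ha : ∀ n x, |a n x| ≤ t n)
    (hτ : ∀ L x, |f x - ∑ n ∈ range (L + 1), a n x| ≤ ∑' n, t (n + (L + 1))) (xs : List X) (L : ℕ) :
    |(xs.map f).prod - truncProd a L xs| ≤ B ^ xs.length - keptSum t xs.length L := by
  have h := abs_prod_sub_truncProd_le (τ := fun L => ∑' n, t (n + (L + 1))) hf ha hτ xs L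
  rwa [tailBound_eq_pow_sub_keptSum (fun L => tsum_shift_eq_sub_sum hsum L)] at h

/-- The bracket form: `truncProd a L xs − τ ≤ Π f(xᵢ) ≤ truncProd a L xs + τ` with `τ = B^k − keptSum t k L`. [folklore] -/
theorem prod_mem_Icc_truncProd {f : X → ℝ} {a : ℕ → X → ℝ} {t : ℕ → ℝ} {B : ℝ}
    (hsum : HasSum t B) (hf : ∀ x, |f x| ≤ B) (ha : ∀ n x, |a n x| ≤ t n)
    (hτ : ∀ L x, |f x - ∑ n ∈ range (L + 1), a n x| ≤ ∑' n, t (n + (L + 1))) (xs : List X) (L : ℕ) :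
    (xs.map f).prod ∈ Set.Icc (truncProd a L xs - (B ^ xs.length - keptSum t xs.length L))
      (truncProd a L xs + (B ^ xs.length - keptSum t xs.length L)) := by
  have h := abs_le.1 (abs_prod_sub_truncProd_le_pow_sub_keptSum hsum hf ha hτ xs L)
  constructor <;> linarith [h.1, h.2]

end Summit.Ventures.YMGap.FlowData.JointCharacterTruncation

end
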